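import Literature.NumberTheory.EllipticCurves.MatsunoCurvesRankDescent
import Mathlib.NumberTheory.RamificationInertia.Basic
import HarnessLib

/-!
# Matsuno 2009, Lemma 5.3: `#K⟮Σ_f, 2⟯ ≤ 2^{7n + 2k + h}` (proof)

`Proofs` companion of `Literature/NumberTheory/EllipticCurves/MatsunoCurvesRankDescent.lean`
(K. Matsuno, *Elliptic curves with large Tate–Shafarevich groups over a number field*, Math. Res.
Lett. **16** (2009), 449–461): it PROVES the first hypothesis `h53` of
`MatsunoParams.mordellWeilRank_le_of_lemma53_of_prop54`, i.e. **Lemma 5.3** (p. 457) in the form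
`#K⟮Σ_f, 2⟯ ≤ 2^{7n + 2k + h}` for Matsuno's parameters over a number field `K` of odd degree
`n = [K : ℚ]` and any `h` with `rk₂ Cl(K) ≤ h` (`MatsunoParams.natCard_unitsModSq_le`).

Printed proof (p. 457): "We have an exact sequence
`1 → O_Σ^×/O_Σ^{×2} → K_Σ → (Cl_Σ(K)[2])^{⊕2} → 1`, where `O_Σ^×` is the group of `Σ`-units of
`K`. Since `K` is a totally real field of degree `n`, there exist exactly `n` archimedean primes.
Since `2st` has at most `6` prime factors, the number of non-archimedean primes in `Σ` is at most
`6n + 2k` by (A3). Hence we have `dim_{𝔽₂} O_Σ^×/O_Σ^{×2} ≤ 7n + 2k`." Mathlib has neither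
`Σ`-units nor `Σ`-class groups, so (as in the tree's finiteness proof
`KummerSelmerGroupFinite.lean`, Silverman *AEC* VIII.1.6) the count is run over `𝓞_K` itself,
with the same three ingredients:

* `IsDedekindDomain.selmerGroup.natCard_le_pow_mul` — **`#K⟮S, n⟯ ≤ n^{#S} · #K⟮∅, n⟯`**: the
  valuation map `K⟮S, n⟯ → (S → ℤ/n)` has kernel `K⟮∅, n⟯` (Mathlib
  `IsDedekindDomain.selmerGroup.valuation_ker_eq`);
* `IsDedekindDomain.selmerGroup.natCard_empty_le_torsion` — **`#K⟮∅, n⟯ ≤ #Cl(R)[n] · #(Rˣ/Rˣⁿ)`**: the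
  exact sequence `1 → Rˣ/Rˣⁿ → K(∅, n) → Cl(R)[n] → 0`, set-theoretically (every class has an
  integral representative `r` with `(r) = Jⁿ`; classes with the same `[J]` differ by a unit) —
  the quantitative form of the tree's `selmerGroup.finite_empty_of_finite_classGroup`;
* `NumberField.Units.natCard_quotient_sq_le_of_odd` — **`#(𝓞_K^×/𝓞_K^{×2}) ≤ 2^n`** for `K` of
  odd degree `n`: Dirichlet's unit theorem (`𝓞_K^× = μ(K) × ℤ^{r}`, `r = #{places} − 1 ≤ n − 1`,
  Mathlib `NumberField.Units.exist_unique_eq_mul_prod`) and `μ(K) = {±1}`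
  (`NumberField.Units.torsionOrder_eq_two_of_odd_finrank`); this is the printed
  "`n` archimedean primes";
* `NumberField.natCard_ker_sq_classGroup_le` — `#Cl(K)[2] ≤ 2^h` when `Cl(K)` contains no
  `(ℤ/2)^{h+1}` (`𝔽₂`-linear algebra, tree `exists_addMonoidHom_injective_of_le_card`);
* `MatsunoParams.natCard_badPrimes_le` — **`#Σ_f ≤ 6n + 2k`**: a prime of `K` dividing `2lm`
  lies over a prime factor of `2lm = 2·s ℓ₁⋯ℓ_k·t m₁ⁿ⋯m_kⁿ`; over each `ℓᵢ`, `mⱼ` there is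
  exactly one ((A3): they remain prime), over each of the at most `6` prime factors of `2st`
  (`Ω(st) ≤ 5`, Lemma 5.2) at most `n` (`Σ e f = n`, Mathlib
  `Ideal.card_primesOverFinset_le_finrank`).

Hence `#K⟮Σ_f, 2⟯ ≤ 2^{6n+2k} · 2^h · 2^n = 2^{7n + 2k + h}`.

## References

* [Matsuno2009] K. Matsuno, Math. Res. Lett. 16 (2009), 449–461, Lemma 5.3 and its proof (p. 457).
* [SilvermanAEC2009] J. H. Silverman, *The Arithmetic of Elliptic Curves*, 2nd ed., proof of
  Prop. VIII.1.6 (the group `K(S, m)`; tree `KummerSelmerGroupFinite.lean`).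

## Design

Theorems only, no definitions, no named facts. The generic counting statements are deliberate
dot-notation extensions of Mathlib's `IsDedekindDomain.selmerGroup` / `NumberField.Units`
namespaces, next to the tree's finiteness theorems they quantify.
-/

noncomputable section

open scoped Classical NumberField nonZeroDivisors

open IsDedekindDomain NumberField

/-! ## `K(S, n)`: quantitative finiteness -/

namespace IsDedekindDomain

variable {R : Type*} [CommRing R] [IsDedekindDomain R] {K : Type*} [Field K] [Algebra R K]
  [IsFractionRing R K]

/-- **`#K⟮S, n⟯ ≤ n^{#S} · #K⟮∅, n⟯`** (`S` finite, `n ≠ 0`): Mathlib's valuation map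
`K⟮S, n⟯ → (S → ℤ/n)` has kernel `K⟮∅, n⟯` (`selmerGroup.valuation_ker_eq`). (Silverman *AEC*,
proof of Prop. VIII.1.6: reduction from `S` to the kernel of the valuations.)
[cite: SilvermanAEC2009, proof of Prop. VIII.1.6] -/
theorem selmerGroup.natCard_le_pow_mul {S : Set (HeightOneSpectrum R)} [Finite S] {n : ℕ}
    [NeZero n] [Finite (selmerGroup (K := K) (S := S) (n := n))] :
    Nat.card (selmerGroup (K := K) (S := S) (n := n)) ≤
      n ^ Nat.card S *
        Nat.card (selmerGroup (K := K) (S := (∅ : Set (HeightOneSpectrum R))) (n := n)) := by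
  set φ := selmerGroup.valuation (K := K) (S := S) (n := n) with hφ
  have h1 := Subgroup.card_eq_card_quotient_mul_card_subgroup φ.ker
  have h2 : Nat.card ((selmerGroup (K := K) (S := S) (n := n)) ⧸ φ.ker) ≤ n ^ Nat.card S := by
    rw [Nat.card_congr (QuotientGroup.quotientKerEquivRange φ).toEquiv]
    calc Nat.card φ.range ≤ Nat.card (S → Multiplicative (ZMod n)) :=
          Nat.card_le_card_of_injective _ Subtype.val_injective
      _ = n ^ Nat.card S := by
          rw [Nat.card_fun, ← Nat.card_congr (Multiplicative.ofAdd (α := ZMod n)), Nat.card_zmod]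
  have h3 : Nat.card φ.ker =
      Nat.card (selmerGroup (K := K) (S := (∅ : Set (HeightOneSpectrum R))) (n := n)) := by
    rw [hφ, selmerGroup.valuation_ker_eq]
    exact Nat.card_congr
      (Subgroup.subgroupOfEquivOfLe (selmerGroup.monotone (Set.empty_subset S))).toEquiv
  rw [h1, h3]
  exact Nat.mul_le_mul_right _ h2

/-- **`#K⟮∅, n⟯ ≤ #Cl(R)[n] · #(Rˣ/Rˣⁿ)`** for the fraction field `K` of a Dedekind domain `R`
with finite class group and finite `Rˣ/Rˣⁿ` (`0 < n`): the exact sequence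
`1 → Rˣ/Rˣⁿ → K(∅, n) → Cl(R)[n] → 0` used set-theoretically — every `s ∈ K⟮∅, n⟯` has an
integral representative `r_s` with `(r_s) = J_sⁿ` (`exists_mk_eq_of_pos`,
`exists_pow_eq_span_singleton_of_dvd_count`), `[J_s] ∈ Cl(R)[n]`, and two classes with the same
`[J_s]` differ by the image of a unit; so `s ↦ ([J_s], unit part)` is injective. Quantitative form
of the tree's `selmerGroup.finite_empty_of_finite_classGroup`, sharpening the tree's
`selmerGroup.natCard_empty_le` (`KummerCharacterCountProofs.lean`, bound by `#Cl(R)`) to the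
`n`-torsion `Cl(R)[n]` — which is what a bound on the `2`-rank of the class group controls
(Silverman *AEC*, proof of Prop. VIII.1.6). [cite: SilvermanAEC2009, proof of Prop. VIII.1.6] -/
theorem selmerGroup.natCard_empty_le_torsion [Finite (ClassGroup R)] {n : ℕ} (hn : 0 < n)
    [Finite (Rˣ ⧸ (powMonoidHom n : Rˣ →* Rˣ).range)]
    [Finite (selmerGroup (K := K) (S := (∅ : Set (HeightOneSpectrum R))) (n := n))] :
    Nat.card (selmerGroup (K := K) (S := (∅ : Set (HeightOneSpectrum R))) (n := n)) ≤
      Nat.card (powMonoidHom n : ClassGroup R →* ClassGroup R).ker *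
        Nat.card (Rˣ ⧸ (powMonoidHom n : Rˣ →* Rˣ).range) := by
  classical
  -- the image of the global units in `Kˣ/(Kˣ)ⁿ`, through `Rˣ/(Rˣ)ⁿ`
  set u : Rˣ →* Kˣ ⧸ (powMonoidHom n : Kˣ →* Kˣ).range :=
    (QuotientGroup.mk' _).comp (Units.map (algebraMap R K : R →* K)) with hu
  have hle : (powMonoidHom n : Rˣ →* Rˣ).range ≤ u.ker := by
    rintro _ ⟨e, rfl⟩
    rw [MonoidHom.mem_ker, hu, MonoidHom.comp_apply, QuotientGroup.mk'_apply,
      QuotientGroup.eq_one_iff, powMonoidHom_apply, map_pow]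
    exact MonoidHom.mem_range.mpr ⟨Units.map (algebraMap R K : R →* K) e, rfl⟩
  set uq : Rˣ ⧸ (powMonoidHom n : Rˣ →* Rˣ).range →* Kˣ ⧸ (powMonoidHom n : Kˣ →* Kˣ).range :=
    QuotientGroup.lift _ u hle with huq
  -- integral representatives `r s` and ideals `J s` with `(J s)ⁿ = (r s)`
  have key : ∀ s : selmerGroup (K := K) (S := (∅ : Set (HeightOneSpectrum R))) (n := n),
      ∃ (r : R) (x : Kˣ) (J : (Ideal R)⁰), r ≠ 0 ∧ (x : K) = algebraMap R K r ∧
        (QuotientGroup.mk x : Kˣ ⧸ (powMonoidHom n : Kˣ →* Kˣ).range) = s ∧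
          (J : Ideal R) ^ n = Ideal.span {r} := by
    intro s
    obtain ⟨r, x, hr, hx, hs⟩ :=
      exists_mk_eq_of_pos (R := R) hn (s : Kˣ ⧸ (powMonoidHom n : Kˣ →* Kˣ).range)
    have hdvd : ∀ v : HeightOneSpectrum R,
        n ∣ (Associates.mk v.asIdeal).count (Associates.mk (Ideal.span {r})).factors := by
      intro v
      have h1 : v.valuationOfNeZeroMod n (s : Kˣ ⧸ (powMonoidHom n : Kˣ →* Kˣ).range) = 1 :=
        s.2 v (Set.notMem_empty v)
      rw [← hs, v.valuationOfNeZeroMod_mk_eq_one_iff,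
        v.toAdd_valuationOfNeZero_of_eq_algebraMap hr hx, dvd_neg] at h1
      exact_mod_cast h1
    obtain ⟨J, hJ⟩ := exists_pow_eq_span_singleton_of_dvd_count hr hdvd
    have hJ0 : J ∈ (Ideal R)⁰ := by
      rw [mem_nonZeroDivisors_iff_ne_zero]
      rintro rfl
      rw [Ideal.zero_eq_bot, ← Ideal.zero_eq_bot, zero_pow hn.ne', Ideal.zero_eq_bot, eq_comm,
        Ideal.span_singleton_eq_bot] at hJ
      exact hr hJ
    exact ⟨r, x, ⟨J, hJ0⟩, hr, hx, hs, hJ⟩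
  choose r x J hr hx hs hJ using key
  -- the class of `J s` is `n`-torsion; its fibres are contained in translates of `u(Rˣ)`
  let f : selmerGroup (K := K) (S := (∅ : Set (HeightOneSpectrum R))) (n := n) → ClassGroup R :=
    fun s => ClassGroup.mk0 (J s)
  have hfker : ∀ s, f s ∈ (powMonoidHom n : ClassGroup R →* ClassGroup R).ker := by
    intro s
    have hmem : Ideal.span {r s} ∈ (Ideal R)⁰ := by
      have h := (J s ^ n).2
      rwa [SubmonoidClass.coe_pow, hJ s] at h
    have hpow : J s ^ n = ⟨Ideal.span {r s}, hmem⟩ :=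
      Subtype.ext (by rw [SubmonoidClass.coe_pow, hJ s])
    rw [MonoidHom.mem_ker, powMonoidHom_apply, ← map_pow, hpow, ClassGroup.mk0_eq_one_iff]
    exact ⟨⟨r s, rfl⟩⟩
  have hfib : ∀ s t, f t = f s →
      ∃ e : Rˣ, (s : Kˣ ⧸ (powMonoidHom n : Kˣ →* Kˣ).range) = t * u e := by
    intro s t hst
    obtain ⟨c, d, hc, hd, hcd⟩ := ClassGroup.mk0_eq_mk0_iff.mp hst
    have h2 : Ideal.span {c ^ n * r t} = Ideal.span {d ^ n * r s} := by
      have := congrArg (· ^ n) hcd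
      simp only [mul_pow, Ideal.span_singleton_pow, hJ] at this
      rwa [Ideal.span_singleton_mul_span_singleton, Ideal.span_singleton_mul_span_singleton] at this
    obtain ⟨e, he⟩ := Ideal.span_singleton_eq_span_singleton.mp h2
    have hcK : algebraMap R K c ≠ 0 := (map_ne_zero_iff _ (IsFractionRing.injective R K)).mpr hc
    have hdK : algebraMap R K d ≠ 0 := (map_ne_zero_iff _ (IsFractionRing.injective R K)).mpr hd
    have hunits : Units.mk0 _ hcK ^ n * x t * Units.map (algebraMap R K : R →* K) e =
        Units.mk0 _ hdK ^ n * x s := by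
      ext
      simp only [Units.val_mul, Units.val_pow_eq_pow_val, Units.val_mk0, Units.coe_map,
        MonoidHom.coe_coe, hx, ← map_pow, ← map_mul, he]
    refine ⟨e, ?_⟩
    rw [← hs, ← hs, hu, MonoidHom.comp_apply, QuotientGroup.mk'_apply, ← QuotientGroup.mk_mul,
      QuotientGroup.eq]
    refine MonoidHom.mem_range.mpr ⟨Units.mk0 _ hdK / Units.mk0 _ hcK, ?_⟩
    rw [powMonoidHom_apply, div_pow, div_eq_iff_eq_mul, mul_assoc, eq_inv_mul_iff_mul_eq]
    simpa only [mul_comm, mul_assoc, mul_left_comm] using hunits.symm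
  -- a section `T` of `f` on its image, and the unit parts `e s`
  let T : ClassGroup R → selmerGroup (K := K) (S := (∅ : Set (HeightOneSpectrum R))) (n := n) :=
    fun g => if h : ∃ s, f s = g then h.choose else 1
  have hT : ∀ s, f (T (f s)) = f s := by
    intro s
    have h : ∃ s', f s' = f s := ⟨s, rfl⟩
    simp only [T, dif_pos h]
    exact h.choose_spec
  choose e he using fun s => hfib s (T (f s)) (hT s)
  -- the injection `s ↦ ([J s], e s)`
  let Φ : selmerGroup (K := K) (S := (∅ : Set (HeightOneSpectrum R))) (n := n) →
      (powMonoidHom n : ClassGroup R →* ClassGroup R).ker ×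
        (Rˣ ⧸ (powMonoidHom n : Rˣ →* Rˣ).range) :=
    fun s => (⟨f s, hfker s⟩, QuotientGroup.mk (e s))
  refine le_of_le_of_eq (Nat.card_le_card_of_injective Φ fun s s' h => ?_) (Nat.card_prod _ _)
  simp only [Φ, Prod.mk.injEq, Subtype.mk.injEq] at h
  obtain ⟨hf, hq⟩ := h
  have hu' : u (e s) = u (e s') := by
    have h' := congrArg uq hq
    rwa [huq, QuotientGroup.lift_mk, QuotientGroup.lift_mk] at h'
  apply Subtype.ext
  rw [he s, he s', hf, hu']

end IsDedekindDomain

/-! ## Units modulo squares and the `2`-torsion of the class group of a number field -/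

namespace NumberField

open NumberField.Units NumberField.InfinitePlace

variable (K : Type*) [Field K] [NumberField K]

/-- **`#(𝓞_K^×/(𝓞_K^×)ⁿ) ≤ #μ(K) · n^{r}`**, `r = rank 𝓞_K^×`: every unit is `ζ ∏ εᵢ^{eᵢ}` for a
fundamental system `εᵢ` (Dirichlet's unit theorem, Mathlib `exist_unique_eq_mul_prod`), and only
`eᵢ mod n` matters modulo `n`-th powers (quantitative form of the tree's
`Units.finite_quotient_range_powMonoidHom`; Silverman *AEC* p. 189, "`R_S^*` is finitely
generated"). [cite: SilvermanAEC2009, proof of Prop. VIII.1.6] -/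
theorem Units.natCard_quotient_pow_le (n : ℕ) [NeZero n] :
    Nat.card ((𝓞 K)ˣ ⧸ (powMonoidHom n : (𝓞 K)ˣ →* (𝓞 K)ˣ).range) ≤
      torsionOrder K * n ^ rank K := by
  classical
  have hsurj : Function.Surjective (fun p : torsion K × (Fin (rank K) → ZMod n) =>
      (QuotientGroup.mk (p.1 * ∏ i, fundSystem K i ^ (p.2 i).val) :
        (𝓞 K)ˣ ⧸ (powMonoidHom n : (𝓞 K)ˣ →* (𝓞 K)ˣ).range)) := by
    intro q
    induction q using QuotientGroup.induction_on with
    | H x =>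
      obtain ⟨⟨ζ, e⟩, hx, -⟩ := exist_unique_eq_mul_prod K x
      refine ⟨⟨ζ, fun i => (e i : ZMod n)⟩, ?_⟩
      dsimp only
      rw [eq_comm, QuotientGroup.eq]
      refine MonoidHom.mem_range.mpr ⟨∏ i, fundSystem K i ^ (-(e i / n)), ?_⟩
      rw [powMonoidHom_apply, hx, mul_inv_rev, mul_assoc, inv_mul_cancel_left,
        ← Finset.prod_pow, ← Finset.prod_inv_distrib, ← Finset.prod_mul_distrib]
      refine Finset.prod_congr rfl fun i _ => ?_
      rw [← zpow_natCast, ← zpow_mul, ← zpow_neg, ← zpow_natCast, ← zpow_add]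
      congr 1
      rw [ZMod.val_intCast, Int.emod_def]
      ring
  calc Nat.card ((𝓞 K)ˣ ⧸ (powMonoidHom n : (𝓞 K)ˣ →* (𝓞 K)ˣ).range)
      ≤ Nat.card (torsion K × (Fin (rank K) → ZMod n)) := Nat.card_le_card_of_surjective _ hsurj
    _ = torsionOrder K * n ^ rank K := by
        rw [Nat.card_prod, Nat.card_fun, Nat.card_zmod, Nat.card_eq_fintype_card (α := Fin (rank K)),
          Fintype.card_fin]
        rfl

/-- `rank 𝓞_K^× + 1 = #{infinite places} ≤ [K : ℚ]` (`r₁ + r₂ ≤ r₁ + 2r₂ = n`). [folklore] -/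
theorem Units.rank_add_one_le_finrank : rank K + 1 ≤ Module.finrank ℚ K := by
  have h1 := card_add_two_mul_card_eq_rank K
  have h2 := card_eq_nrRealPlaces_add_nrComplexPlaces K
  have hpos : 0 < Fintype.card (InfinitePlace K) := Fintype.card_pos
  rw [rank]
  omega

/-- **`#(𝓞_K^×/𝓞_K^{×2}) ≤ 2^{[K:ℚ]}` for a number field of odd degree** (then `μ(K) = {±1}`,
Mathlib `torsionOrder_eq_two_of_odd_finrank`, and `rank 𝓞_K^× ≤ [K : ℚ] − 1`): the contribution
"`dim_{𝔽₂} O^×/O^{×2} = n`" of the `n` archimedean primes in Matsuno's count (p. 457, proof of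
Lemma 5.3, `Σ`-units replaced by units). [cite: Matsuno2009, proof of Lemma 5.3] -/
theorem Units.natCard_quotient_sq_le_of_odd (hodd : Odd (Module.finrank ℚ K)) :
    Nat.card ((𝓞 K)ˣ ⧸ (powMonoidHom 2 : (𝓞 K)ˣ →* (𝓞 K)ˣ).range) ≤ 2 ^ Module.finrank ℚ K := by
  calc Nat.card ((𝓞 K)ˣ ⧸ (powMonoidHom 2 : (𝓞 K)ˣ →* (𝓞 K)ˣ).range)
      ≤ torsionOrder K * 2 ^ rank K := Units.natCard_quotient_pow_le K 2
    _ = 2 ^ (rank K + 1) := by rw [torsionOrder_eq_two_of_odd_finrank hodd, pow_succ, mul_comm]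
    _ ≤ 2 ^ Module.finrank ℚ K := Nat.pow_le_pow_right two_pos (Units.rank_add_one_le_finrank K)

/-- **`#Cl(K)[2] ≤ 2^h` if `Cl(K)` contains no `(ℤ/2ℤ)^{h+1}`** (the meaning of "`h ≥` the
`2`-rank of the class group" in the hypotheses of `Matsuno2009_cor55`/`cor56`): `Cl(K)[2]` is an
`𝔽₂`-vector space of some dimension `d`, of order `2^d`, containing `(ℤ/2)^d`
(tree `exists_addMonoidHom_injective_of_le_card`). [folklore] -/
theorem natCard_ker_sq_classGroup_le {h : ℕ}
    (hh : ¬ ∃ g : (Fin (h + 1) → ZMod 2) →+ Additive (ClassGroup (𝓞 K)), Function.Injective g) :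
    Nat.card (powMonoidHom 2 : ClassGroup (𝓞 K) →* ClassGroup (𝓞 K)).ker ≤ 2 ^ h := by
  set T := (powMonoidHom 2 : ClassGroup (𝓞 K) →* ClassGroup (𝓞 K)).ker with hTdef
  -- `Additive T` is a finite group killed by `2`
  have h2 : ∀ x : Additive T, 2 • x = 0 := by
    intro x
    have hx : ((Additive.toMul x : T) : ClassGroup (𝓞 K)) ^ 2 = 1 := (Additive.toMul x).2
    apply Additive.toMul.injective
    rw [toMul_nsmul, toMul_zero]
    exact Subtype.ext hx
  by_contra hlt
  rw [not_le] at hlt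
  letI : Module (ZMod 2) (Additive T) := AddCommGroup.zmodModule h2
  have hcard : Nat.card (Additive T) = 2 ^ Module.finrank (ZMod 2) (Additive T) := by
    rw [Module.natCard_eq_pow_finrank (K := ZMod 2), Nat.card_zmod]
  have hT : Nat.card T = Nat.card (Additive T) := rfl
  have hle : 2 ^ (h + 1) ≤ Nat.card (Additive T) := by
    rw [hT, hcard] at hlt
    rw [hcard]
    exact Nat.pow_le_pow_right two_pos ((Nat.pow_lt_pow_iff_right (by norm_num)).mp hlt)
  obtain ⟨g, hg⟩ := Literature.NumberTheory.EllipticCurves.exists_addMonoidHom_injective_of_le_card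
    h2 hle
  refine hh ⟨(MonoidHom.toAdditive T.subtype).comp g, fun a b hab => hg ?_⟩
  have hab' : T.subtype (Additive.toMul (g a)) = T.subtype (Additive.toMul (g b)) := hab
  exact Additive.toMul.injective (Subtype.val_injective hab')

/-- **`#K⟮∅, 2⟯ ≤ 2^{[K:ℚ] + h}`** for a number field `K` of odd degree whose class group contains
no `(ℤ/2ℤ)^{h+1}`: `#K⟮∅,2⟯ ≤ #Cl(K)[2] · #(𝓞_K^×/𝓞_K^{×2}) ≤ 2^h · 2^n`.
[cite: Matsuno2009, proof of Lemma 5.3] -/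
theorem natCard_selmerGroup_empty_two_le (hodd : Odd (Module.finrank ℚ K)) {h : ℕ}
    (hh : ¬ ∃ g : (Fin (h + 1) → ZMod 2) →+ Additive (ClassGroup (𝓞 K)), Function.Injective g) :
    Nat.card (IsDedekindDomain.selmerGroup (R := 𝓞 K) (K := K)
        (S := (∅ : Set (HeightOneSpectrum (𝓞 K)))) (n := 2)) ≤ 2 ^ (Module.finrank ℚ K + h) := by
  haveI : Finite ((𝓞 K)ˣ ⧸ (powMonoidHom 2 : (𝓞 K)ˣ →* (𝓞 K)ˣ).range) :=
    Units.finite_quotient_range_powMonoidHom K 2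
  haveI : Finite (IsDedekindDomain.selmerGroup (R := 𝓞 K) (K := K)
      (S := (∅ : Set (HeightOneSpectrum (𝓞 K)))) (n := 2)) :=
    NumberField.finite_selmerGroup K Set.finite_empty two_pos
  calc _ ≤ Nat.card (powMonoidHom 2 : ClassGroup (𝓞 K) →* ClassGroup (𝓞 K)).ker *
        Nat.card ((𝓞 K)ˣ ⧸ (powMonoidHom 2 : (𝓞 K)ˣ →* (𝓞 K)ˣ).range) :=
        IsDedekindDomain.selmerGroup.natCard_empty_le_torsion two_pos
    _ ≤ 2 ^ h * 2 ^ Module.finrank ℚ K :=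
        Nat.mul_le_mul (natCard_ker_sq_classGroup_le K hh) (Units.natCard_quotient_sq_le_of_odd K hodd)
    _ = 2 ^ (Module.finrank ℚ K + h) := by rw [← pow_add, add_comm]

/-! ## Primes of `K` over a rational prime -/

/-- **At most `[K : ℚ]` primes of `K` lie over a rational prime `q`** (the fundamental identity
`Σ eᵢ fᵢ = [K : ℚ]`, Mathlib `Ideal.card_primesOverFinset_le_finrank`, transported to
`HeightOneSpectrum (𝓞 K)` by `HeightOneSpectrum.equivPrimesOver`). [folklore] -/
theorem natCard_heightOneSpectrum_mem_le_finrank {q : ℕ} (hq : q.Prime) :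
    Nat.card {v : HeightOneSpectrum (𝓞 K) // (q : 𝓞 K) ∈ v.asIdeal} ≤ Module.finrank ℚ K := by
  have hq0 : (q : ℤ) ≠ 0 := by exact_mod_cast hq.ne_zero
  have hp0 : (Ideal.span {(q : ℤ)} : Ideal ℤ) ≠ ⊥ := by
    rw [Ne, Ideal.span_singleton_eq_bot]; exact hq0
  haveI : (Ideal.span {(q : ℤ)} : Ideal ℤ).IsMaximal :=
    ((Ideal.span_singleton_prime hq0).mpr (Nat.prime_iff_prime_int.mp hq)).isMaximal hp0
  have hmap : Ideal.map (algebraMap ℤ (𝓞 K)) (Ideal.span {(q : ℤ)}) = Ideal.span {(q : 𝓞 K)} := by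
    rw [Ideal.map_span, Set.image_singleton, map_natCast]
  have e := IsDedekindDomain.HeightOneSpectrum.equivPrimesOver (𝓞 K)
    (p := Ideal.span {(q : ℤ)}) hp0
  calc Nat.card {v : HeightOneSpectrum (𝓞 K) // (q : 𝓞 K) ∈ v.asIdeal}
      = Nat.card {v : HeightOneSpectrum (𝓞 K) //
          v.asIdeal ∣ Ideal.map (algebraMap ℤ (𝓞 K)) (Ideal.span {(q : ℤ)})} :=
        Nat.card_congr (Equiv.subtypeEquivRight fun v => by rw [hmap, Ideal.dvd_span_singleton])
    _ = Nat.card ((Ideal.span {(q : ℤ)}).primesOver (𝓞 K)) := Nat.card_congr e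
    _ = (IsDedekindDomain.primesOverFinset (Ideal.span {(q : ℤ)}) (𝓞 K)).card := by
        rw [← IsDedekindDomain.coe_primesOverFinset hp0 (𝓞 K), Nat.card_coe_set_eq,
          Set.ncard_coe_finset]
    _ ≤ Module.finrank ℚ K := Ideal.card_primesOverFinset_le_finrank (𝓞 K) ℚ K hp0

/-- **A rational prime which remains prime in `K` has exactly one prime of `K` above it** (here:
at most one; (A3) "all `ℓ₁, ⋯, ℓ_k, m₁, ⋯, m_k` remain prime in `K`" enters Lemma 5.3 through
"the number of non-archimedean primes in `Σ` is at most `6n + 2k` by (A3)").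
[cite: Matsuno2009, proof of Lemma 5.3] -/
theorem natCard_heightOneSpectrum_mem_le_one {q : ℕ} (hq0 : q ≠ 0)
    (hq : (Ideal.span ({(q : 𝓞 K)} : Set (𝓞 K))).IsPrime) :
    Nat.card {v : HeightOneSpectrum (𝓞 K) // (q : 𝓞 K) ∈ v.asIdeal} ≤ 1 := by
  have hbot : Ideal.span ({(q : 𝓞 K)} : Set (𝓞 K)) ≠ ⊥ := by
    rw [Ne, Ideal.span_singleton_eq_bot]; exact_mod_cast hq0
  have hmax : (Ideal.span ({(q : 𝓞 K)} : Set (𝓞 K))).IsMaximal := hq.isMaximal hbot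
  have heq : ∀ u : HeightOneSpectrum (𝓞 K), (q : 𝓞 K) ∈ u.asIdeal →
      u.asIdeal = Ideal.span {(q : 𝓞 K)} := fun u hu =>
    (hmax.eq_of_le u.isPrime.ne_top ((Ideal.span_singleton_le_iff_mem _).mpr hu)).symm
  haveI : Finite {v : HeightOneSpectrum (𝓞 K) // (q : 𝓞 K) ∈ v.asIdeal} := by
    have h := Ideal.finite_factors (I := Ideal.span {(q : 𝓞 K)}) hbot
    refine (h.subset fun v (hv : (q : 𝓞 K) ∈ v.asIdeal) => ?_).to_subtype
    rw [Set.mem_setOf_eq, Ideal.dvd_span_singleton]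
    exact hv
  rw [Finite.card_le_one_iff_subsingleton]
  exact ⟨fun ⟨v, hv⟩ ⟨w, hw⟩ =>
    Subtype.ext (HeightOneSpectrum.ext (by rw [heq v hv, heq w hw]))⟩

end NumberField

/-! ## `#Σ_f ≤ 6n + 2k` and Lemma 5.3 -/

namespace Literature.NumberTheory.EllipticCurves

namespace MatsunoParams

open Finset

variable {K : Type*} [Field K] [NumberField K] {n k : ℕ} (P : MatsunoParams K n k)

/-- A prime factor of `2lm = 2 · s ℓ₁⋯ℓ_k · t m₁ⁿ⋯m_kⁿ` other than the `ℓᵢ`, `mⱼ` divides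
`2st`. [cite: Matsuno2009, proof of Lemma 5.3] -/
theorem mem_primeFactors_two_mul_s_mul_t {p : ℕ} (hp : p ∈ (2 * P.bigL * P.bigM).primeFactors)
    (hℓ : ∀ i, p ≠ P.ℓ i) (hm : ∀ j, p ≠ P.m j) : p ∈ (2 * (P.s * P.t)).primeFactors := by
  rw [Nat.mem_primeFactors] at hp ⊢
  obtain ⟨hpp, hdvd, -⟩ := hp
  refine ⟨hpp, ?_, Nat.mul_ne_zero two_ne_zero P.st_ne_zero⟩
  have hL : p ∣ P.bigL → p ∣ P.s := fun h => by
    rcases (Nat.Prime.dvd_mul hpp).mp (show p ∣ P.s * ∏ i, P.ℓ i from h) with h | h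
    · exact h
    · obtain ⟨i, -, hi⟩ := (Prime.dvd_finsetProd_iff hpp.prime _).mp h
      exact absurd ((Nat.prime_dvd_prime_iff_eq hpp (P.prime_ℓ i)).mp hi) (hℓ i)
  have hM : p ∣ P.bigM → p ∣ P.t := fun h => by
    rcases (Nat.Prime.dvd_mul hpp).mp (show p ∣ P.t * ∏ j, P.m j ^ n from h) with h | h
    · exact h
    · obtain ⟨j, -, hj⟩ := (Prime.dvd_finsetProd_iff hpp.prime _).mp h
      exact absurd ((Nat.prime_dvd_prime_iff_eq hpp (P.prime_m j)).mp (hpp.dvd_of_dvd_pow hj))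
        (hm j)
  rcases (Nat.Prime.dvd_mul hpp).mp hdvd with h | h
  · rcases (Nat.Prime.dvd_mul hpp).mp h with h | h
    · exact h.mul_right _
    · exact (Dvd.dvd.mul_right (hL h) _).mul_left _
  · exact (Dvd.dvd.mul_left (hM h) _).mul_left _

/-- `2st` has at most `6` prime factors ("Since `2st` has at most `6` prime factors", p. 457;
Lemma 5.2: `Ω(st) ≤ 5`). [cite: Matsuno2009, proof of Lemma 5.3] -/
theorem card_primeFactors_two_mul_s_mul_t_le : (2 * (P.s * P.t)).primeFactors.card ≤ 6 := by
  rw [Nat.primeFactors_mul two_ne_zero P.st_ne_zero, Nat.Prime.primeFactors Nat.prime_two]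
  calc ({2} ∪ (P.s * P.t).primeFactors).card ≤ ({2} : Finset ℕ).card + (P.s * P.t).primeFactors.card :=
        Finset.card_union_le _ _
    _ ≤ 1 + 5 := by
        refine Nat.add_le_add (by rw [Finset.card_singleton]) ?_
        exact (List.toFinset_card_le _).trans P.length_primeFactorsList_le

/-- A prime `v` of `K` dividing `2lm` contains a prime factor `p` of `2lm`. [folklore] -/
theorem exists_mem_primeFactors_of_mem_badPrimes {v : HeightOneSpectrum (𝓞 K)}
    (hv : v ∈ P.badPrimes) : ∃ p ∈ (2 * P.bigL * P.bigM).primeFactors, (p : 𝓞 K) ∈ v.asIdeal := by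
  have hN : ((2 * P.bigL * P.bigM : ℕ) : 𝓞 K) =
      ∏ p ∈ (2 * P.bigL * P.bigM).primeFactors, (p : 𝓞 K) ^ (2 * P.bigL * P.bigM).factorization p := by
    conv_lhs => rw [← Nat.prod_factorization_pow_eq_self
      (Nat.mul_ne_zero (Nat.mul_ne_zero two_ne_zero (by rw [P.bigL_eq]; omega)) P.bigM_ne_zero)]
    rw [Nat.prod_factorization_eq_prod_primeFactors]
    push_cast
    rfl
  have h : ((2 * P.bigL * P.bigM : ℕ) : 𝓞 K) ∈ v.asIdeal := hv
  rw [hN, Ideal.IsPrime.prod_mem_iff] at h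
  obtain ⟨p, hp, hpv⟩ := h
  exact ⟨p, hp, Ideal.IsPrime.mem_of_pow_mem inferInstance _ hpv⟩

/-- **"The number of non-archimedean primes in `Σ` is at most `6n + 2k` by (A3)"** (p. 457): the
primes of `K` dividing `2lm` lie over the prime factors of `2lm`; over each `ℓᵢ` and each `mⱼ`
there is exactly one (they remain prime in `K`, (A3)), and over each of the at most `6` prime
factors of `2st` there are at most `n = [K : ℚ]`. [cite: Matsuno2009, proof of Lemma 5.3] -/
theorem natCard_badPrimes_le (hK : Module.finrank ℚ K = n) : Nat.card P.badPrimes ≤ 6 * n + 2 * k := by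
  set T := (2 * P.bigL * P.bigM).primeFactors with hTdef
  -- the primes of `K` above a rational prime `p`
  let F : ℕ → Type _ := fun p => {v : HeightOneSpectrum (𝓞 K) // (p : 𝓞 K) ∈ v.asIdeal}
  have hFfin : ∀ p : ℕ, p ≠ 0 → Finite (F p) := fun p hp => by
    have hbot : Ideal.span ({(p : 𝓞 K)} : Set (𝓞 K)) ≠ ⊥ := by
      rw [Ne, Ideal.span_singleton_eq_bot]; exact_mod_cast hp
    have h := Ideal.finite_factors (I := Ideal.span {(p : 𝓞 K)}) hbot
    refine (h.subset fun v (hv : (p : 𝓞 K) ∈ v.asIdeal) => ?_).to_subtype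
    rw [Set.mem_setOf_eq, Ideal.dvd_span_singleton]
    exact hv
  haveI : ∀ p : T, Finite (F p) := fun p => hFfin p (Nat.prime_of_mem_primeFactors p.2).ne_zero
  -- `Σ_f ↪ Σ_{p ∣ 2lm} {v : p ∈ v}`
  have hchoice : ∀ v : P.badPrimes, ∃ p : T, ((p : ℕ) : 𝓞 K) ∈ (v : HeightOneSpectrum (𝓞 K)).asIdeal :=
    fun v => by
      obtain ⟨p, hp, hpv⟩ := P.exists_mem_primeFactors_of_mem_badPrimes v.2
      exact ⟨⟨p, hp⟩, hpv⟩
  choose π hπ using hchoice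
  have h1 : Nat.card P.badPrimes ≤ Nat.card (Σ p : T, F p) := by
    refine Nat.card_le_card_of_injective (fun v => ⟨π v, ⟨v, hπ v⟩⟩) fun v w hvw => ?_
    have h := congrArg (fun x : (Σ p : T, F p) => (x.2 : HeightOneSpectrum (𝓞 K))) hvw
    exact Subtype.ext h
  have h2 : Nat.card (Σ p : T, F p) = ∑ p ∈ T, Nat.card (F p) := by
    rw [Nat.card_sigma]
    exact Finset.sum_coe_sort T fun p => Nat.card (F p)
  -- fibres: `≤ 1` over the `ℓᵢ`, `mⱼ`; `≤ n` over the prime factors of `2st`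
  set T₂ : Finset ℕ := Finset.univ.image P.ℓ ∪ Finset.univ.image P.m with hT₂
  have hle : ∀ p ∈ T, Nat.card (F p) ≤ if p ∈ T₂ then 1 else n := by
    intro p hp
    have hpp := Nat.prime_of_mem_primeFactors hp
    split_ifs with h
    · rw [hT₂, Finset.mem_union, Finset.mem_image, Finset.mem_image] at h
      rcases h with ⟨i, -, rfl⟩ | ⟨j, -, rfl⟩
      · exact NumberField.natCard_heightOneSpectrum_mem_le_one K (P.prime_ℓ i).ne_zero
          (P.isPrime_span_ℓ i)
      · exact NumberField.natCard_heightOneSpectrum_mem_le_one K (P.prime_m j).ne_zero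
          (P.isPrime_span_m j)
    · exact (NumberField.natCard_heightOneSpectrum_mem_le_finrank K hpp).trans hK.le
  have hT₂card : T₂.card ≤ 2 * k := by
    calc T₂.card ≤ (Finset.univ.image P.ℓ).card + (Finset.univ.image P.m).card :=
          Finset.card_union_le _ _
      _ ≤ k + k := Nat.add_le_add (Finset.card_image_le.trans (by simp))
          (Finset.card_image_le.trans (by simp))
      _ = 2 * k := by ring
  have hrest : (T.filter fun p => p ∉ T₂) ⊆ (2 * (P.s * P.t)).primeFactors := by
    intro p hp
    rw [Finset.mem_filter] at hp
    refine P.mem_primeFactors_two_mul_s_mul_t hp.1 (fun i hi => hp.2 ?_) (fun j hj => hp.2 ?_)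
    · rw [hT₂, Finset.mem_union, Finset.mem_image]
      exact Or.inl ⟨i, Finset.mem_univ i, hi.symm⟩
    · rw [hT₂, Finset.mem_union, Finset.mem_image, Finset.mem_image]
      exact Or.inr ⟨j, Finset.mem_univ j, hj.symm⟩
  calc Nat.card P.badPrimes ≤ ∑ p ∈ T, Nat.card (F p) := h2 ▸ h1
    _ ≤ ∑ p ∈ T, (if p ∈ T₂ then 1 else n) := Finset.sum_le_sum hle
    _ = ∑ p ∈ T.filter (fun p => p ∈ T₂), 1 + ∑ p ∈ T.filter (fun p => p ∉ T₂), n := by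
        rw [← Finset.sum_filter_add_sum_filter_not T (fun p => p ∈ T₂)]
        congr 1
        · exact Finset.sum_congr rfl fun p hp => if_pos (Finset.mem_filter.mp hp).2
        · exact Finset.sum_congr rfl fun p hp => if_neg (Finset.mem_filter.mp hp).2
    _ = (T.filter fun p => p ∈ T₂).card + n * (T.filter fun p => p ∉ T₂).card := by
        simp only [Finset.sum_const, smul_eq_mul]
        ring
    _ ≤ T₂.card + n * (2 * (P.s * P.t)).primeFactors.card :=
        Nat.add_le_add (Finset.card_le_card fun p hp => (Finset.mem_filter.mp hp).2)
          (Nat.mul_le_mul_left _ (Finset.card_le_card hrest))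
    _ ≤ 2 * k + n * 6 := Nat.add_le_add hT₂card
          (Nat.mul_le_mul_left _ P.card_primeFactors_two_mul_s_mul_t_le)
    _ = 6 * n + 2 * k := by ring

/-- **Matsuno 2009, Lemma 5.3** (p. 457), in the form used by Corollary 5.5
(`MatsunoParams.mordellWeilRank_le_of_lemma53_of_prop54`, hypothesis `h53`): for Matsuno's
parameters over a number field `K` of odd degree `n = [K : ℚ]` and any `h` such that `Cl(𝓞_K)`
contains no `(ℤ/2ℤ)^{h+1}` (`rk₂ Cl_Σ(K) ≤ rk₂ Cl(K) ≤ h`),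
**`#K⟮Σ_f, 2⟯ ≤ 2^{7n + 2k + h}`** — printed: `dim_{𝔽₂} K_Σ/L ≤ 14n + 2h`, i.e.
`dim K_Σ = 2 dim K⟮Σ_f, 2⟯ ≤ 2(7n + 2k) + 2h`. Proof as printed with `Σ`-units replaced by units:
`#K⟮Σ_f,2⟯ ≤ 2^{#Σ_f} #K⟮∅,2⟯ ≤ 2^{6n+2k} · 2^{n} · 2^{h}`. [cite: Matsuno2009, Lemma 5.3] -/
theorem natCard_unitsModSq_le (hK : Module.finrank ℚ K = n) (hn : Odd n) {h : ℕ}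
    (hh : ¬ ∃ g : (Fin (h + 1) → ZMod 2) →+ Additive (ClassGroup (𝓞 K)), Function.Injective g) :
    Nat.card P.unitsModSq ≤ 2 ^ (7 * n + 2 * k + h) := by
  haveI : Finite (IsDedekindDomain.selmerGroup (R := 𝓞 K) (K := K) (S := P.badPrimes) (n := 2)) :=
    P.finite_unitsModSq
  haveI : Finite P.badPrimes := P.finite_badPrimes.to_subtype
  have hodd : Odd (Module.finrank ℚ K) := hK ▸ hn
  have h1 := IsDedekindDomain.selmerGroup.natCard_le_pow_mul (K := K) (S := P.badPrimes) (n := 2)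
  have h2 := NumberField.natCard_selmerGroup_empty_two_le K hodd hh
  have h3 := P.natCard_badPrimes_le hK
  rw [hK] at h2
  calc Nat.card P.unitsModSq ≤ 2 ^ Nat.card P.badPrimes *
        Nat.card (IsDedekindDomain.selmerGroup (R := 𝓞 K) (K := K)
          (S := (∅ : Set (HeightOneSpectrum (𝓞 K)))) (n := 2)) := h1
    _ ≤ 2 ^ (6 * n + 2 * k) * 2 ^ (n + h) :=
        Nat.mul_le_mul (Nat.pow_le_pow_right two_pos h3) h2
    _ = 2 ^ (7 * n + 2 * k + h) := by rw [← pow_add]; congr 1; ring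

end MatsunoParams

end Literature.NumberTheory.EllipticCurves

end
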